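import Summits.BirchSwinnertonDyer.Rank1Residual.Partition.MainConjecturesIrreducibleBDP
import Literature.NumberTheory.EllipticCurves.YanZhu2026.BDPMainConjectureRationalAtTrivialCharacter
import HarnessLib

/-!
# The (IMC≥∘BDP)ᵍ link at EVERY good ordinary `p ≥ 3` (so also `p = 3`) with `ρ̄_E|G_K` irreducible —
# FROM PUBLISHED FACTS: Yan–Zhu 2026 Thm. 5.7 (1) (rational BDP main conjecture) + BCS 2025 Prop. 4.2.2
# (`μ(L_p^BDP) = 0`) ∘ CGLS 2022 Thm. 5.1.3 (`YanZhu2026.thm57_bcs422_cgls513_generator_constantCoeff`,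
# typed p543659) + Jetchev–Skinner–Wan 2017 Thm. 3.3.1 (cell `bsd-print-x9`, prover seat p4; the `p ≥ 3`
# twin of `PrintX9HeegnerIMCLink.lean`, which reads BCS 2025 Thm. 1.2.4 (a) at `p > 3`)

HONEST FRAMING (cell `run/shared/lean/pub/bsd-print-x9/`, D-0131 print tier): THEOREMS ONLY (no
definition, no new named fact, nothing booked). The rank-one Heegner roads of the cell (route `PrintX9`
rev 1 at `p ≥ 5`; the road-B twin for the `p = 3` leaf `X10.BSDpOnClassX10b`) consume STEP L = the
one-sided link `X11b.IMCLowerWaldspurgerOnTreeGoodAt p κ (inducedPlace ι) γ ι P` at a classical Heegner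
datum. At `p > 3` it is `PrintX9HeegnerIMCLink.lean` (BCS 1.2.4 (a)); THIS FILE gives it at every
`p ≥ 3` from the Yan–Zhu composite fact (same conclusion letter for letter, binders `3 ≤ p`, good
ordinary, (irr_K) — no (irr_ℚ), no (sur), no (im)), by the same four steps: §1 the CGLS-letter link
given a generator; §2 the generator from JSW 3.3.1 at `embAt v̄`; §3 the JSW letter at `inducedPlace ι`
via the σ-bridge (`padicLogOrd_comp_eq_of_rank_one`); §4 the `hLA` binder at a classical Heegner datum
(rank one / finiteness over `K` by Kolyvagin). CONDITIONAL on the cited facts (binders `h57`, `h331`,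
`hKo`); flags of record on the fact: `YZ26@3-BF-ERL-Ohta` (cell documentation), BCS 4.2.2 via Hsieh.

References: [YanZhu2024MainConjNonCM] Thm. 5.7 (1) (J. Algebra 693 (2026)); [BurungaleCastellaSkinner2025]
Prop. 4.2.2; [CastellaGrossiLeeSkinner2022] Thm. 5.1.3; [JetchevSkinnerWan2017] Thm. 3.3.1, §7.4.1;
[Castella2018] Thm. 2.3, §5; [Kolyvagin1990] Thm. A.
-/

set_option autoImplicit false

noncomputable section

open scoped Classical

open WeierstrassCurve NumberField IsDedekindDomain Literature.NumberTheory.EllipticCurves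
  Literature.NumberTheory.EllipticCurves.ModularForms Literature.NumberTheory.Automorphic
  Literature.NumberTheory.EllipticCurves.Rank1Residual
  Literature.NumberTheory.EllipticCurves.BurungaleCastellaSkinner2025
  Literature.NumberTheory.EllipticCurves.CastellaGrossiLeeSkinner2022
  Literature.NumberTheory.EllipticCurves.JetchevSkinnerWan2017
  Summit.BirchSwinnertonDyer.BirchSwinnertonDyer.Theorems.Rank1ResidualX1Defs

namespace Summit.BirchSwinnertonDyer.Rank1Residual

namespace X11b

/-! ### §1 `IMCLowerWaldspurgerOnTreeGoodAt` (CGLS letter) from the (irr) fact, given a generator -/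

section IMC

variable {W : WeierstrassCurve ℚ} [W.IsElliptic] [W.IsGloballyMinimal] {p : ℕ} [Fact p.Prime]
  {K : Type} [Field K] [NumberField K]

/-- **`X11b.IMCLowerWaldspurgerOnTreeGoodAt p κ v̄ γ ι P` FROM Yan–Zhu 2026 Thm. 5.7 (1) + BCS 2025
Prop. 4.2.2 ∘ CGLS 2022 Thm. 5.1.3**, at every datum of the fact — `p ≥ 3` good ordinary, `K` imaginary quadratic with (Heeg) for `N = N_E`, (spl), (disc)
`D_K` odd `≠ −3`, (irr_K), `ι : K ↪ ℚ_p` inducing `v`, `v̄ ∋ p` the other (STRICT) prime, `κ`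
anticyclotomic with generator `γ`, `P = P_K` the Heegner point of `(Dt, H, ιC)` — for a
parametrisation with `p ∤ c_E` (then the Manin term of the fact vanishes), GIVEN one generator `G`
of `ch_Λ(X_Gr)` with `G(0) ≠ 0` (supplied by a control theorem, §2): the ONE-SIDED inequality
`2·(ord_p log_ω P + ord_p(1 − a_p + p) − 1) ≤ ord_p G(0)` (the defect being the exponent `k = μ(G) ≥ 0`
of the fact). Through the defeq bridge (`AcSelmer.hasCharValuationAt_iff_literature`,
`padicLogOrd_eq_literature`). The `p ≥ 3` twin of `imcLowerWaldspurgerOnTreeGoodAt_of_thm124a`.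
[cite: BurungaleCastellaSkinner2025, Thm. 1.2.4 (a) (p. 3), Prop. 4.2.2 (pp. 8–9) and proof of Cor. 1.3.1 (p. 4)]
[cite: CastellaGrossiLeeSkinner2022, Thm. 5.1.3] [cite: Castella2018, §5 (eq:IMC+BDP) (arXiv:1704.06608 p. 12)] -/
theorem imcLowerWaldspurgerOnTreeGoodAt_of_thm57
    (h57 : YanZhu2026.thm57_bcs422_cgls513_generator_constantCoeff)
    (hp : 3 ≤ p) (hord : GoodOrd W p) (hK : IsImaginaryQuadratic K)
    (hodd : Odd (NumberField.discr K)) (h3 : NumberField.discr K ≠ -3)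
    {N : ℕ} [NeZero N] (hN : W.conductorNorm ℤ = N) (hHN : SatisfiesHeegnerHypothesis N K)
    (hHp : SatisfiesHeegnerHypothesis p K) (hirrK : (W.baseChange K).HasIrreducibleModPGaloisRep p)
    (ι : K →+* ℚ_[p]) (v vbar : HeightOneSpectrum (𝓞 K))
    (hv : ∀ x : 𝓞 K, x ∈ v.asIdeal ↔ ‖ι (x : K)‖ < 1)
    (hvbar : ((p : ℕ) : 𝓞 K) ∈ vbar.asIdeal) (hne : vbar ≠ v)
    (κ : ZpExtension K p) (hκ : κ.IsAnticyclotomic)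
    (γ : Field.absoluteGaloisGroup K) [Fact (κ.IsTopGenerator γ)]
    (Dt : ModularParametrizationData W N) (hc : ¬ (p : ℤ) ∣ Dt.c)
    (H : HeegnerDatum N (NumberField.discr K)) (ιC : K →+* ℂ) (P : (W.baseChange K).toAffine.Point)
    (hP : WeierstrassCurve.Affine.Point.map ιC.toRatAlgHom P = heegnerPointComplex Dt H)
    (G : IwasawaAlgebra p)
    (hG : Literature.NumberTheory.EllipticCurves.Castella2018.AcSelmer.XAc.charIdeal (W.baseChange K) p
      κ vbar ∅ γ = Ideal.span {G})
    (hG0 : PowerSeries.constantCoeff G ≠ 0) :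
    IMCLowerWaldspurgerOnTreeGoodAt p κ vbar γ ι P := by
  have hHN' : SatisfiesHeegnerHypothesis (W.conductorNorm ℤ) K := by rw [hN]; exact hHN
  obtain ⟨n, hn, hval⟩ := YanZhu2026.hasCharValuationAt_ge_of_thm57 h57 hp hord K hK hHN' hHp hodd h3
    hirrK ι v vbar hv hvbar hne κ hκ γ Dt H ιC P hP G hG hG0
  have hc0 : padicValInt p Dt.c = 0 := padicValInt.eq_zero_of_not_dvd hc
  refine ⟨n, (AcSelmer.hasCharValuationAt_iff_literature _ p κ vbar ∅ γ n).mpr hn, ?_⟩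
  rw [padicLogOrd_eq_literature]
  omega

/-! ### §2 The generator from the published control theorem (JSW 3.3.1: (irr_K), NOT (sur)) -/

/-- **(IMC≥∘BDP)ᵍ, CGLS letter, from YZ 5.7 (1) + BCS 4.2.2 ∘ CGLS 5.1.3 + JSW 3.3.1** — NO anomaly
restriction, NO surjectivity: the generator with `𝓕(0) ≠ 0` of `ch_Λ(X_ac)` for the module STRICT AT
`v̄` comes from Jetchev–Skinner–Wan 2017 Thm. 3.3.1 applied at THE embedding `embAt v̄ : K ↪ K_v̄ = ℚ_p`
(`mem_asIdeal_iff_norm_embAt_lt_one`; `v̄` has degree one as `p` splits); its hypothesis (irr_K) is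
carried (`hirrK`) — the SAME binder the fact needs for Prop. 4.2.2. The `p ≥ 3` twin of
`imcLowerWaldspurgerOnTreeGoodAt_of_thm124a_of_thm331`. [cite: YanZhu2024MainConjNonCM, Thm. 5.7 (1) (§5.2)]
[cite: BurungaleCastellaSkinner2025, Prop. 4.2.2] [cite: CastellaGrossiLeeSkinner2022, Thm. 5.1.3] [cite: JetchevSkinnerWan2017, Thm. 3.3.1] -/
theorem imcLowerWaldspurgerOnTreeGoodAt_of_thm57_of_thm331
    (h57 : YanZhu2026.thm57_bcs422_cgls513_generator_constantCoeff) (h331 : thm331_anticyclotomicControl)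
    (hp : 3 ≤ p) (hord : GoodOrd W p)
    (hK : IsImaginaryQuadratic K) (hodd : Odd (NumberField.discr K)) (h3 : NumberField.discr K ≠ -3)
    {N : ℕ} [NeZero N] (hN : W.conductorNorm ℤ = N) (hHN : SatisfiesHeegnerHypothesis N K)
    (hHp : SatisfiesHeegnerHypothesis p K) (hirrK : (W.baseChange K).HasIrreducibleModPGaloisRep p)
    (ι : K →+* ℚ_[p]) (v vbar : HeightOneSpectrum (𝓞 K))
    (hv : ∀ x : 𝓞 K, x ∈ v.asIdeal ↔ ‖ι (x : K)‖ < 1)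
    (hvbar : ((p : ℕ) : 𝓞 K) ∈ vbar.asIdeal) (hne : vbar ≠ v)
    (κ : ZpExtension K p) (hκ : κ.IsAnticyclotomic)
    (γ : Field.absoluteGaloisGroup K) [Fact (κ.IsTopGenerator γ)]
    (Dt : ModularParametrizationData W N) (hc : ¬ (p : ℤ) ∣ Dt.c)
    (H : HeegnerDatum N (NumberField.discr K)) (ιC : K →+* ℂ) (P : (W.baseChange K).toAffine.Point)
    (hP : WeierstrassCurve.Affine.Point.map ιC.toRatAlgHom P = heegnerPointComplex Dt H)
    (hrk : (W.baseChange K).mordellWeilRank = 1)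
    (hfinp : Finite (AddCommGroup.primaryComponent (W.baseChange K).sha p))
    (hPinf : ¬ IsOfFinAddOrder P) :
    IMCLowerWaldspurgerOnTreeGoodAt p κ vbar γ ι P := by
  have hHN' : SatisfiesHeegnerHypothesis (W.conductorNorm ℤ) K := by rw [hN]; exact hHN
  -- `v̄` has degree one (`p` splits in the quadratic `K`), so `embAt v̄ : K ↪ ℚ_p` induces `v̄`
  have hsplit : SplitsIn K p := hHp p Fact.out (dvd_refl p)
  obtain ⟨he, hf⟩ := degreeOne_of_splitsIn hK.1 hsplit hvbar
  obtain ⟨-, F, hF, hF0, -⟩ := h331 W p (by omega) hord.1 K hK hHp hHN' hirrK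
    (embAt K p vbar hvbar he hf) vbar (mem_asIdeal_iff_norm_embAt_lt_one vbar hvbar he hf) κ hκ γ hrk
    hfinp P hPinf
  exact imcLowerWaldspurgerOnTreeGoodAt_of_thm57 h57 hp hord hK hodd h3 hN hHN hHp hirrK ι v
    vbar hv hvbar hne κ hκ γ Dt hc H ιC P hP F hF hF0

/-! ### §3 The JSW letter: module strict at the induced prime, log along the same embedding -/

/-- **(IMC≥∘BDP)ᵍ in the JSW / Castella letter `IMCLowerWaldspurgerOnTreeGoodAt p κ (inducedPlace ι) γ ι
P` from YZ 5.7 (1) + BCS 4.2.2 ∘ CGLS 5.1.3 + JSW 3.3.1**, for EVERY embedding `ι : K ↪ ℚ_p`, in rank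
one, with `E[p]` irreducible (surjective or not). Let `v = inducedPlace ι` and `w ≠ v` the other prime
above `p` (`exists_other_prime`); the fact at the embedding `embAt w` (inducing `w`), strict prime `v`,
gives `2·(ord_p(1 − a_p + p) − 1 + ord_p log_{embAt w} P) ≤ ord_p 𝓖(0)` for every generator `𝓖` of
`ch_Λ(X_ac(κ, v))` with `𝓖(0) ≠ 0` — one exists by JSW 3.3.1 at `(ι, v)` —, and `embAt w = ι ∘ σ` for
an involution `σ` of `K` (`exists_involutive_comp_eq`), so `ord_p log_{embAt w} P = ord_p log_ι P`
(`padicLogOrd_comp_eq_of_rank_one`: `σ_* P = ±P +` torsion in rank one, `p ≠ 2`). The `p ≥ 3` twin of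
`imcLowerWaldspurgerOnTreeGoodAt_inducedPlace_of_thm124a_of_thm331`.
[cite: YanZhu2024MainConjNonCM, Thm. 5.7 (1) (§5.2)] [cite: BurungaleCastellaSkinner2025, Prop. 4.2.2] [cite: CastellaGrossiLeeSkinner2022, Thm. 5.1.3]
[cite: JetchevSkinnerWan2017, Thm. 3.3.1, §2.3.2 (p. 7)] [cite: Castella2018, Thm. 2.3, §5 (eq:IMC+BDP)] -/
theorem imcLowerWaldspurgerOnTreeGoodAt_inducedPlace_of_thm57_of_thm331
    (h57 : YanZhu2026.thm57_bcs422_cgls513_generator_constantCoeff) (h331 : thm331_anticyclotomicControl)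
    (hp : 3 ≤ p) (hord : GoodOrd W p)
    (hK : IsImaginaryQuadratic K) (hodd : Odd (NumberField.discr K)) (h3 : NumberField.discr K ≠ -3)
    {N : ℕ} [NeZero N] (hN : W.conductorNorm ℤ = N) (hHN : SatisfiesHeegnerHypothesis N K)
    (hHp : SatisfiesHeegnerHypothesis p K) (hirrK : (W.baseChange K).HasIrreducibleModPGaloisRep p)
    (ι : K →+* ℚ_[p]) (κ : ZpExtension K p) (hκ : κ.IsAnticyclotomic)
    (γ : Field.absoluteGaloisGroup K) [Fact (κ.IsTopGenerator γ)]
    (Dt : ModularParametrizationData W N) (hc : ¬ (p : ℤ) ∣ Dt.c)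
    (H : HeegnerDatum N (NumberField.discr K)) (ιC : K →+* ℂ) (P : (W.baseChange K).toAffine.Point)
    (hP : WeierstrassCurve.Affine.Point.map ιC.toRatAlgHom P = heegnerPointComplex Dt H)
    (hrk : (W.baseChange K).mordellWeilRank = 1)
    (hfinp : Finite (AddCommGroup.primaryComponent (W.baseChange K).sha p))
    (hPinf : ¬ IsOfFinAddOrder P) :
    IMCLowerWaldspurgerOnTreeGoodAt p κ (inducedPlace ι) γ ι P := by
  have hHN' : SatisfiesHeegnerHypothesis (W.conductorNorm ℤ) K := by rw [hN]; exact hHN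
  -- the other prime `w` above `p`, of degree one, and THE embedding at it
  obtain ⟨w, hw, hwne⟩ := exists_other_prime hHp (inducedPlace ι) (natCast_mem_inducedPlace ι)
  have hsplit : SplitsIn K p := hHp p Fact.out (dvd_refl p)
  obtain ⟨he, hf⟩ := degreeOne_of_splitsIn hK.1 hsplit hw
  set ιw : K →+* ℚ_[p] := embAt K p w hw he hf with hιw
  -- a generator with non-zero constant term of the module strict at `v = inducedPlace ι`, from JSW
  obtain ⟨-, F, hF, hF0, -⟩ := h331 W p (by omega) hord.1 K hK hHp hHN' hirrK ι (inducedPlace ι)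
    (mem_inducedPlace_iff ι) κ hκ γ hrk hfinp P hPinf
  -- BCS (a) + 4.2.2 ∘ BDP at the embedding `ιw` (inducing `w`), strict prime `inducedPlace ι`
  obtain ⟨n, hn, hval⟩ := YanZhu2026.hasCharValuationAt_ge_of_thm57 h57 hp hord K hK hHN' hHp hodd h3
    hirrK ιw w (inducedPlace ι) (mem_asIdeal_iff_norm_embAt_lt_one w hw he hf)
    (natCast_mem_inducedPlace ι) (fun h ↦ hwne h.symm) κ hκ γ Dt H ιC P hP F hF hF0
  -- `ιw = ι ∘ σ` for an involution `σ`; the log valuations agree in rank one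
  obtain ⟨σ, hσ, hισ⟩ := exists_involutive_comp_eq hK.1 ι ιw
  have hlog : Literature.NumberTheory.EllipticCurves.padicLogOrd W p ιw P = padicLogOrd W p ι P := by
    rw [← hισ, ← padicLogOrd_eq_literature]
    exact padicLogOrd_comp_eq_of_rank_one W p (by omega) σ hσ ι hrk P hPinf
  have hc0 : padicValInt p Dt.c = 0 := padicValInt.eq_zero_of_not_dvd hc
  refine ⟨n, (AcSelmer.hasCharValuationAt_iff_literature _ p κ (inducedPlace ι) ∅ γ n).mpr hn, ?_⟩
  rw [hlog] at hval
  omega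

end IMC

/-! ### §4 The `hLA` binder of the rank-one theorems at a classical Heegner datum, DISCHARGED under (irr) -/

section Datum

variable (W : WeierstrassCurve ℚ) [W.IsElliptic] [W.IsGloballyMinimal] (p : ℕ) [Fact p.Prime]
  (N : ℕ) [NeZero N] (K : Type) [Field K] [NumberField K]
  (Dt : ModularParametrizationData W N) (H : HeegnerDatum N (NumberField.discr K)) (ιC : K →+* ℂ)
  (P : (W.baseChange K).toAffine.Point)

/-- **The `hLA` binder (JSW letter) at a classical Heegner datum with `P_K` non-torsion, from BCS
1.2.4 (a) + 4.2.2 ∘ CGLS 5.1.3 + JSW 3.3.1 + the σ-bridge** — every pair `p ≥ 3` good ordinary with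
`ρ̄_E|G_K` irreducible, anomalous or not; (irr_K) carried; rank one and finite `Ш` over
`K` by Kolyvagin (`hKo`); `d_K < −4` gives `d_K ≠ −3`. The `p ≥ 3` twin of
`imcLowerWaldspurgerOnTreeGoodAt_inducedPlace_of_heegner_of_thm124a_of_thm331`; at `p = 3` (class X10b)
it is the only one that applies. [cite: YanZhu2024MainConjNonCM, Thm. 5.7 (1) (§5.2)] [cite: BurungaleCastellaSkinner2025, Prop. 4.2.2]
[cite: JetchevSkinnerWan2017, Thm. 3.3.1, §7.4.1] [cite: Kolyvagin1990, Thm. A] -/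
theorem imcLowerWaldspurgerOnTreeGoodAt_inducedPlace_of_heegner_of_thm57_of_thm331
    (h57 : YanZhu2026.thm57_bcs422_cgls513_generator_constantCoeff) (h331 : thm331_anticyclotomicControl)
    (hKo : kolyvagin N W K)
    (hp : 3 ≤ p) (hord : GoodOrd W p)
    (hirrK : (W.baseChange K).HasIrreducibleModPGaloisRep p)
    (hN : W.conductorNorm ℤ = N) (hK : IsImaginaryQuadratic K)
    (hodd : Odd (NumberField.discr K)) (hlt : NumberField.discr K < -4)
    (hHN : SatisfiesHeegnerHypothesis N K) (hHp : SatisfiesHeegnerHypothesis p K)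
    (hP : WeierstrassCurve.Affine.Point.map ιC.toRatAlgHom P = heegnerPointComplex Dt H)
    (hc : ¬ (p : ℤ) ∣ Dt.c) (hPinf : ¬ IsOfFinAddOrder P) {κ : ZpExtension K p} (hκ : κ.IsAnticyclotomic)
    {γ : Field.absoluteGaloisGroup K} [Fact (κ.IsTopGenerator γ)] (ι : K →+* ℚ_[p]) :
    IMCLowerWaldspurgerOnTreeGoodAt p κ (inducedPlace ι) γ ι P := by
  obtain ⟨hrk, hsha⟩ := hKo hK hHN ⟨Dt, H, ιC, hP⟩ hPinf
  haveI : Finite (W.baseChange K).sha := hsha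
  exact imcLowerWaldspurgerOnTreeGoodAt_inducedPlace_of_thm57_of_thm331 h57 h331 hp hord hK hodd
    (by omega) hN hHN hHp hirrK ι κ hκ γ Dt hc H ιC P hP hrk inferInstance hPinf

end Datum

end X11b

end Summit.BirchSwinnertonDyer.Rank1Residual

end
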